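import Summits.QuantumFields.QCD.Theses.NestedDissectionSea

/-!
# Crux `CoerciveSea` (stmt-QuantumFields-13901), line `chirality-collapses-pseudospectrum`,
# stub `stub_achiralPileupRareOfPinned` (B″-law) — the one-site exposure of its `∀ reg` form

The stub asserts, for EVERY regularisation `reg` satisfying (ii) windowed dilution + (iii) parity pin
(the body of `NegativeCellsDilute`), a `k`-uniform power law `P(B″_t) ≤ C t^α` for the achiral
sheet-weighted pile-up event `B″` of the Hermitian Dirichlet Wilson cell pencil
`D_c(μ) u = ev · Γ_c u` (`D_c(μ) = wilsonCell U μ 0 s`) on every window box `b₀ ≤ s_i`, at the sea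
mass `μ = m_f(k) = mcrit k + a_k m_f / Z_m k`.  This file makes the exposure of that `∀ reg` form
exact, over the VERBATIM event of the registered stub:

* `wilsonCell_oneSiteBox` — on the one-site box `s = (2,2,2,2)` (admissible when `b₀ = 2`) the cell
  has no hopping entries: `wilsonCell U μ 0 (2,2,2,2) = (μ + 4)·1` for every gauge field
  (`siteBox_two_ne_shift`: two sites of that box are never neighbours); at `μ = −4` it vanishes
  (`wilsonCell_oneSiteBox_neg_four`); its children interior is empty
  (`not_childrenInterior_oneSiteBox`), so the separator is the whole box.
* `achiralPileup_oneSiteBox_neg_four` — hence at bare mass `−4` EXACTLY the B″ event holds for EVERY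
  `SU(3)` field on every torus of side `N ≥ 2`, every level `τ > 0` and every cut `χ₀ > 0`: the
  normalised `u ∝ 1_{α ∈ {0,2}}` is an eigenvector with `ev = 0`, exactly achiral (`χ(u) = 0`, the
  spin swap `0 ↔ 2` reverses `(γ₅)_{αα} = (1,1,−1,−1)_α`), with sheet fraction `1`, and the weight
  `wgt = 1/(4τ) + 1` (`wgt·|ev| = 0 ≤ 1`) piles `> 1/(4τ)`.
* `achiralPileup_oneSiteBox_empty_of_ne` — conversely, at every cell mass `μ ≠ −4` the B″ event on
  that box is EMPTY for every field, level `τ ≥ 0` and cut `χ₀ ≤ 1` (every pencil eigenvector of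
  `(μ+4)·1` is chiral): the exposure is exactly the point `−4`.
* `achiralPileup_ratio_oneSiteBox_neg_four` — in the stub's currency: the phase-quenched ratio of
  `B″` (VERBATIM the stub's `P`) on that box at cell mass `−4` equals `1` whenever its normaliser is
  non-zero; with `τ = t/2` this is incompatible with any `C t^α`, `α > 0`, uniformly in `t ∈ (0,1]`.

Consequence for the line.  No `k`-uniform `(C, α)` exists for a regularisation whose sea mass equals
`−4` for infinitely many `k` (at `b₀ = 2`; the box `(2,2,2,2)` is in the window as soon as
`2 a_k ≤ ℓ`).  `mcrit` is free data of `QCDRegularisation`: `mcrit k = −4 − a_k q_k / Z_m k` with `q_k`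
running through the positive rationals with infinite repetition (slowly enough that
`a_k q_k / Z_m k → 0`) has `HasMassScaling`/`HasAsymptoticScaling` untouched and defeats every
threshold `M₁` (all `m_f = q > M₁` rational give sea mass `−4` infinitely often).  Whether such a
regularisation can satisfy (ii)+(iii) is unknown — the pin only places the sea masses in `(−8, 0)`
eventually (`CoerciveSeaNegative.PinClause.mass_mem_Ioo`) — so a proof of the stub as typed must
extract from (ii)+(iii) that the sea masses stay away from `−4`; the alternative is a guard in the
statement (e.g. `∃ η > 0, ∀ᶠ k, η ≤ |mcrit k + 4|`, which with `m_f(k) − mcrit k → 0` makes the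
one-site pencil `±(μ+4)Γ_c`-chiral and the event empty there).  The same mechanism acts on the chain
boxes `(n,2,2,2)`, `n ≤ 4` (nilpotent hopping, `det D_c = (μ+4)^{dim}`, exactly achiral kernel at
`−4`, near-kernel pencil eigenvalues `O((μ+4)²)`); not formalised here.
-/

noncomputable section

open scoped BigOperators Classical ComplexConjugate
open MeasureTheory Filter Matrix
open Literature.MathematicalPhysics.QuantumLattice Literature.MathematicalPhysics.QuantumFieldTheory
  Literature.Probability.LatticeModels

namespace Summit.QuantumFields.QCD.Cruxes.CoerciveSea.ChiralityCollapsesPseudospectrum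

variable {N : ℕ} [NeZero N]

/-- `Σ_p conj(v_p) v_p = 1` gives `Σ_p ‖v_p‖² = 1`. -/
private theorem oneSite_sum_norm_sq_eq_one {ι : Type*} [Fintype ι] (v : ι → ℂ)
    (h : ∑ p, star (v p) * v p = 1) : ∑ p, ‖v p‖ ^ 2 = 1 := by
  have hsum : (∑ p, star (v p) * v p) = ((∑ p, ‖v p‖ ^ 2 : ℝ) : ℂ) := by
    rw [Complex.ofReal_sum]
    refine Finset.sum_congr rfl fun p _ => ?_
    rw [Complex.ofReal_pow, ← Complex.conj_mul']
    rfl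
  rw [hsum] at h
  exact_mod_cast h

/-! ## The exposure: on the one-site box the event is certain at bare mass `−4` -/

/-- Two sites of the corner-`0` box of sides `(2,2,2,2)` are never lattice neighbours (every
coordinate of both has value `1`; a forward hop would need `1 = 0` in `ZMod N`, i.e. `N = 1`, where
the box is empty). -/
theorem siteBox_two_ne_shift {y y' : TorusSite 4 N}
    (hy : siteBox (0 : TorusSite 4 N) (fun _ => 2) y) (hy' : siteBox (0 : TorusSite 4 N) (fun _ => 2) y')
    (μ : Fin 4) : y' ≠ Site.shift y μ := by
  intro h
  obtain ⟨h1, h2⟩ := hy μ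
  obtain ⟨h1', h2'⟩ := hy' μ
  simp only [Pi.zero_apply, sub_zero] at h1 h2 h1' h2'
  have hv : (y μ).val = (y' μ).val := by omega
  have heq : y μ = y' μ := ZMod.val_injective N hv
  have hμ : y' μ = y μ + 1 := by
    rw [h]
    simp [Literature.MathematicalPhysics.QuantumFieldTheory.Site.shift]
  rw [heq] at hμ
  have h10 : (1 : ZMod N) = 0 := by
    have := hμ.symm
    rwa [add_eq_left] at this
  have hN : N = 1 := by
    have h' : ((1 : ℕ) : ZMod N) = 0 := by exact_mod_cast h10
    exact Nat.dvd_one.mp ((ZMod.natCast_eq_zero_iff 1 N).mp h')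
  have hlt := ZMod.val_lt (y μ)
  omega

/-- **The one-site cell.** On the corner-`0` box of sides `(2,2,2,2)` (one site, `12` indices) the
Dirichlet Wilson cell has no hopping entries: `wilsonCell U μ 0 (2,2,2,2) = (μ + 4) · 1` for every
gauge field. -/
theorem wilsonCell_oneSiteBox (U : GaugeConfig 4 N (Matrix.specialUnitaryGroup (Fin 3) ℂ)) (μ : ℝ) :
    wilsonCell U μ 0 (fun _ => 2) = ((μ + 4 : ℝ) : ℂ) • (1 : Matrix _ _ ℂ) := by
  ext p q
  have hp : siteBox (0 : TorusSite 4 N) (fun _ => 2) (p : TorusSite 4 N × Fin 3 × Fin 4).1 := p.2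
  have hq : siteBox (0 : TorusSite 4 N) (fun _ => 2) (q : TorusSite 4 N × Fin 3 × Fin 4).1 := q.2
  have h1 : ∀ ν : Fin 4, (q : TorusSite 4 N × Fin 3 × Fin 4).1 ≠
      Site.shift (p : TorusSite 4 N × Fin 3 × Fin 4).1 ν := fun ν => siteBox_two_ne_shift hp hq ν
  have h2 : ∀ ν : Fin 4, (p : TorusSite 4 N × Fin 3 × Fin 4).1 ≠
      Site.shift (q : TorusSite 4 N × Fin 3 × Fin 4).1 ν := fun ν => siteBox_two_ne_shift hq hp ν
  simp only [wilsonCell, Matrix.toSquareBlockProp_def, Matrix.of_apply, wilsonDirac, h1, h2,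
    if_false, add_zero, Finset.sum_const_zero, mul_zero, sub_zero, Matrix.smul_apply,
    Matrix.one_apply, Subtype.val_inj, smul_eq_mul, mul_ite, mul_one]

/-- At bare mass `−4` the one-site cell is the zero matrix. -/
theorem wilsonCell_oneSiteBox_neg_four (U : GaugeConfig 4 N (Matrix.specialUnitaryGroup (Fin 3) ℂ)) :
    wilsonCell U (-4) 0 (fun _ => 2) = 0 := by
  rw [wilsonCell_oneSiteBox]
  norm_num

omit [NeZero N] in
/-- The one-site box has no children interior (every child has a side `1`, i.e. is empty): its
separator is the whole box. -/
theorem not_childrenInterior_oneSiteBox (p : {p // wilsonBox (0 : TorusSite 4 N) (fun _ => 2) p}) :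
    ¬ childrenInterior (fun _ => 2) p := by
  rintro ⟨ε, hε⟩
  obtain ⟨h0, h1⟩ := hε 0
  revert h1 h0
  simp only [halfSides]
  split_ifs <;> omega

/-- **EXPOSURE of the `∀ reg` form: on the one-site box the B″ event is CERTAIN at bare mass `−4`.**
For every torus side `N ≥ 2`, every `SU(3)` gauge field `U`, every level `τ > 0` and every cut
`χ₀ > 0`, the achiral pile-up event of `stub_achiralPileupRareOfPinned` holds on the box
`s = (2,2,2,2)` at cell mass `−4`: the cell vanishes (`wilsonCell_oneSiteBox_neg_four`), so the
normalised vector `u ∝ 1_{α ∈ {0,2}}` is an eigenvector with `ev = 0`, EXACTLY achiral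
(`χ(u) = 0`: the spin swap `0 ↔ 2` reverses `(γ₅)_{αα} = (1,1,−1,−1)_α`), and, the children
interior being empty, its sheet fraction is `1`; the weight `wgt = 1/(4τ) + 1` is admissible
(`wgt·|ev| = 0 ≤ 1`) and piles `> 1/(4τ)`.  Hence for a regularisation whose sea mass
`mcrit k + a_k m_f / Z_m k` equals `−4` for infinitely many `k` (at `b₀ = 2`, `ℓ ≥ 2a_k`) the stub's
ratio is `1` whenever the normaliser is non-zero, and no `k`-uniform `C t^α` bound holds; the
stub's hypothesis is not known to exclude this (the pin gives only `(−8,0)`). -/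
theorem achiralPileup_oneSiteBox_neg_four (hN : 2 ≤ N)
    (U : GaugeConfig 4 N (Matrix.specialUnitaryGroup (Fin 3) ℂ)) (τ χ₀ : ℝ) (hτ : 0 < τ) (hχ₀ : 0 < χ₀) :
    ∃ n : ℕ, ∃ u : Fin n → ({p // wilsonBox (0 : TorusSite 4 N) (fun _ => 2) p} → ℂ), ∃ ev wgt : Fin n → ℝ, (∀ i j, ∑ p, star (u i p) * u j p = if i = j then 1 else 0) ∧ (∀ j, (wilsonCell U (-4) 0 (fun _ => 2)).mulVec (u j) = fun p => (ev j : ℂ) * gammaFive p.1.2.2 p.1.2.2 * u j p) ∧ (∀ j, |ev j| < 2 * τ ∧ 0 ≤ wgt j ∧ wgt j * |ev j| ≤ 1) ∧ (∀ j, ‖∑ p, star (u j p) * gammaFive p.1.2.2 p.1.2.2 * u j p‖ < χ₀) ∧ 1 / (4 * τ) < ∑ j, wgt j * ∑ p, if childrenInterior (fun _ => (2 : ℕ)) p then (0 : ℝ) else ‖u j p‖ ^ 2 := by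
  haveI : Fact (1 < N) := ⟨hN⟩
  -- the box and the achiral seed vector
  set B := {p // wilsonBox (0 : TorusSite 4 N) (fun _ => 2) p} with hB
  let w : B → ℂ := fun p => if (p : TorusSite 4 N × Fin 3 × Fin 4).2.2 = 0 ∨
      (p : TorusSite 4 N × Fin 3 × Fin 4).2.2 = 2 then 1 else 0
  have hw01 : ∀ p, ‖w p‖ ^ 2 = if (p : TorusSite 4 N × Fin 3 × Fin 4).2.2 = 0 ∨
      (p : TorusSite 4 N × Fin 3 × Fin 4).2.2 = 2 then (1 : ℝ) else 0 := by
    intro p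
    by_cases hp : (p : TorusSite 4 N × Fin 3 × Fin 4).2.2 = 0 ∨ (p : TorusSite 4 N × Fin 3 × Fin 4).2.2 = 2
    · simp [w, hp]
    · simp [w, hp]
  -- a witness index: the site `(1,1,1,1)`, colour `0`, spin `0`
  have hbox : wilsonBox (0 : TorusSite 4 N) (fun _ => 2) ((fun _ => (1 : ZMod N)), (0 : Fin 3), (0 : Fin 4)) := by
    intro i
    simp [ZMod.val_one]
  set p₀ : B := ⟨((fun _ => (1 : ZMod N)), (0 : Fin 3), (0 : Fin 4)), hbox⟩ with hp₀
  set S : ℝ := ∑ p, ‖w p‖ ^ 2 with hS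
  have hS_pos : 0 < S := by
    have h0 : ‖w p₀‖ ^ 2 = 1 := by rw [hw01]; simp [hp₀]
    have hle : ‖w p₀‖ ^ 2 ≤ S :=
      Finset.single_le_sum (f := fun p => ‖w p‖ ^ 2) (fun p _ => by positivity) (Finset.mem_univ p₀)
    linarith
  -- the chirality of `w` vanishes: spin swap `0 ↔ 2`
  have hchi_w : ∑ p, star (w p) * gammaFive (p : TorusSite 4 N × Fin 3 × Fin 4).2.2
      (p : TorusSite 4 N × Fin 3 × Fin 4).2.2 * w p = 0 := by
    -- the summand as a real sign pattern
    have hterm : ∀ p : B, star (w p) * gammaFive (p : TorusSite 4 N × Fin 3 × Fin 4).2.2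
        (p : TorusSite 4 N × Fin 3 × Fin 4).2.2 * w p =
        if (p : TorusSite 4 N × Fin 3 × Fin 4).2.2 = 0 then 1
        else if (p : TorusSite 4 N × Fin 3 × Fin 4).2.2 = 2 then -1 else 0 := by
      intro p
      rw [gammaFive_eq_diagonal, Matrix.diagonal_apply_eq]
      rcases p with ⟨⟨x, a, α⟩, hp⟩
      fin_cases α <;> simp [w]
    simp_rw [hterm]
    -- the swap of spins `0` and `2` is an involution of the box reversing the sign pattern
    let e : (TorusSite 4 N × Fin 3 × Fin 4) ≃ (TorusSite 4 N × Fin 3 × Fin 4) :=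
      Equiv.prodCongr (Equiv.refl _) (Equiv.prodCongr (Equiv.refl _) (Equiv.swap (0 : Fin 4) 2))
    have he : ∀ q : TorusSite 4 N × Fin 3 × Fin 4,
        wilsonBox (0 : TorusSite 4 N) (fun _ => 2) q ↔ wilsonBox (0 : TorusSite 4 N) (fun _ => 2) (e q) :=
      fun q => Iff.rfl
    let σ : B ≃ B := e.subtypeEquiv he
    have hσ : ∀ p : B, ((σ p : B) : TorusSite 4 N × Fin 3 × Fin 4).2.2 =
        Equiv.swap (0 : Fin 4) 2 (p : TorusSite 4 N × Fin 3 × Fin 4).2.2 := fun p => rfl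
    have hflip : ∀ p : B,
        (if ((σ p : B) : TorusSite 4 N × Fin 3 × Fin 4).2.2 = 0 then (1 : ℂ)
          else if ((σ p : B) : TorusSite 4 N × Fin 3 × Fin 4).2.2 = 2 then -1 else 0) =
        -(if (p : TorusSite 4 N × Fin 3 × Fin 4).2.2 = 0 then (1 : ℂ)
          else if (p : TorusSite 4 N × Fin 3 × Fin 4).2.2 = 2 then -1 else 0) := by
      intro p
      rw [hσ]
      rcases p with ⟨⟨x, a, α⟩, hp⟩
      fin_cases α <;> simp [Equiv.swap_apply_of_ne_of_ne, Equiv.swap_apply_left, Equiv.swap_apply_right]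
    have hsum := Equiv.sum_comp σ (fun p : B =>
      (if (p : TorusSite 4 N × Fin 3 × Fin 4).2.2 = 0 then (1 : ℂ)
        else if (p : TorusSite 4 N × Fin 3 × Fin 4).2.2 = 2 then -1 else 0))
    simp only [hflip, Finset.sum_neg_distrib] at hsum
    -- `-X = X` in `ℂ`
    linear_combination (-(1 : ℂ) / 2) * hsum
  -- the normalised vector
  let v : B → ℂ := fun p => w p / (Real.sqrt S : ℂ)
  have hsqrt_pos : 0 < Real.sqrt S := Real.sqrt_pos.mpr hS_pos
  have hsqrt_ne : (Real.sqrt S : ℂ) ≠ 0 := by exact_mod_cast hsqrt_pos.ne'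
  have hv_term : ∀ p, star (v p) * v p = (((‖w p‖ ^ 2 / S : ℝ)) : ℂ) := by
    intro p
    have hsq : (Real.sqrt S : ℂ) * (Real.sqrt S : ℂ) = (S : ℂ) := by
      rw [← Complex.ofReal_mul, Real.mul_self_sqrt hS_pos.le]
    simp only [v, star_div₀, Complex.star_def, Complex.conj_ofReal]
    rw [div_mul_div_comm, Complex.conj_mul', hsq, Complex.ofReal_div, Complex.ofReal_pow]
  have hv_unit : ∑ p, star (v p) * v p = 1 := by
    simp_rw [hv_term]
    rw [← Complex.ofReal_sum, ← Finset.sum_div, ← hS, div_self hS_pos.ne', Complex.ofReal_one]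
  have hv_normsq : ∑ p, ‖v p‖ ^ 2 = 1 := oneSite_sum_norm_sq_eq_one v hv_unit
  have hv_chi : ∑ p, star (v p) * gammaFive (p : TorusSite 4 N × Fin 3 × Fin 4).2.2
      (p : TorusSite 4 N × Fin 3 × Fin 4).2.2 * v p = 0 := by
    have hfac : ∀ p : B, star (v p) * gammaFive (p : TorusSite 4 N × Fin 3 × Fin 4).2.2
        (p : TorusSite 4 N × Fin 3 × Fin 4).2.2 * v p =
        (star (w p) * gammaFive (p : TorusSite 4 N × Fin 3 × Fin 4).2.2
          (p : TorusSite 4 N × Fin 3 × Fin 4).2.2 * w p) / ((Real.sqrt S : ℂ) * (Real.sqrt S : ℂ)) := by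
      intro p
      simp only [v, star_div₀, Complex.star_def, Complex.conj_ofReal]
      field_simp
    simp_rw [hfac]
    rw [← Finset.sum_div, hchi_w, zero_div]
  -- assemble the family of one member
  refine ⟨1, fun _ => v, fun _ => 0, fun _ => 1 / (4 * τ) + 1, ?_, ?_, ?_, ?_, ?_⟩
  · intro i j
    rw [if_pos (Subsingleton.elim i j)]
    exact hv_unit
  · intro j
    rw [wilsonCell_oneSiteBox_neg_four, Matrix.zero_mulVec]
    funext p
    simp
  · intro j
    refine ⟨by simpa using hτ, by positivity, by simp⟩
  · intro j
    rw [hv_chi, norm_zero]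
    exact hχ₀
  · have hsheet : ∑ p, (if childrenInterior (fun _ => (2 : ℕ)) p then (0 : ℝ) else ‖v p‖ ^ 2) = 1 := by
      rw [← hv_normsq]
      refine Finset.sum_congr rfl fun p _ => ?_
      rw [if_neg (not_childrenInterior_oneSiteBox p)]
    simp only [Finset.univ_unique, Finset.sum_singleton, hsheet, mul_one]
    linarith

/-- **The exposure, in the stub's currency.** On the one-site box at cell mass `−4` the
phase-quenched ratio of the B″ event — VERBATIM the stub's `P`, for any torus side `N ≥ 2`,
coupling `β`, flavour number and weight masses `mq` — equals `1` as soon as the normaliser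
`∫ Π_f ‖det D_W(U, mq f)‖ dμ_β` is non-zero (the indicator is identically `1`,
`achiralPileup_oneSiteBox_neg_four`).  With `τ = t/2` this is `P(B″_t) = 1` for every `t ∈ (0,1]`,
incompatible with any bound `C t^α`, `α > 0`. -/
theorem achiralPileup_ratio_oneSiteBox_neg_four (N : ℕ) [NeZero N] (hN : 2 ≤ N) (β : ℝ) (Nf : ℕ)
    (mq : Fin Nf → ℝ) (τ χ₀ : ℝ) (hτ : 0 < τ) (hχ₀ : 0 < χ₀)
    (hZ : (∫ U : GaugeConfig 4 N (Matrix.specialUnitaryGroup (Fin 3) ℂ), ∏ f, ‖fermionDet (wilsonDirac (fundamentalRep (Fin 3)) U (mq f) 1)‖ ∂(wilsonMeasure (fundamentalRep (Fin 3)) β)) ≠ 0) :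
    (∫ U : GaugeConfig 4 N (Matrix.specialUnitaryGroup (Fin 3) ℂ), (if (∃ n : ℕ, ∃ u : Fin n → ({p // wilsonBox (0 : TorusSite 4 N) (fun _ => 2) p} → ℂ), ∃ ev wgt : Fin n → ℝ, (∀ i j, ∑ p, star (u i p) * u j p = if i = j then 1 else 0) ∧ (∀ j, (wilsonCell U (-4) 0 (fun _ => 2)).mulVec (u j) = fun p => (ev j : ℂ) * gammaFive p.1.2.2 p.1.2.2 * u j p) ∧ (∀ j, |ev j| < 2 * τ ∧ 0 ≤ wgt j ∧ wgt j * |ev j| ≤ 1) ∧ (∀ j, ‖∑ p, star (u j p) * gammaFive p.1.2.2 p.1.2.2 * u j p‖ < χ₀) ∧ 1 / (4 * τ) < ∑ j, wgt j * ∑ p, if childrenInterior (fun _ => (2 : ℕ)) p then (0 : ℝ) else ‖u j p‖ ^ 2) then (1 : ℝ) else 0) * ∏ f, ‖fermionDet (wilsonDirac (fundamentalRep (Fin 3)) U (mq f) 1)‖ ∂(wilsonMeasure (fundamentalRep (Fin 3)) β)) /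
        (∫ U : GaugeConfig 4 N (Matrix.specialUnitaryGroup (Fin 3) ℂ), ∏ f, ‖fermionDet (wilsonDirac (fundamentalRep (Fin 3)) U (mq f) 1)‖ ∂(wilsonMeasure (fundamentalRep (Fin 3)) β)) = 1 := by
  have hE : ∀ U : GaugeConfig 4 N (Matrix.specialUnitaryGroup (Fin 3) ℂ), (∃ n : ℕ, ∃ u : Fin n → ({p // wilsonBox (0 : TorusSite 4 N) (fun _ => 2) p} → ℂ), ∃ ev wgt : Fin n → ℝ, (∀ i j, ∑ p, star (u i p) * u j p = if i = j then 1 else 0) ∧ (∀ j, (wilsonCell U (-4) 0 (fun _ => 2)).mulVec (u j) = fun p => (ev j : ℂ) * gammaFive p.1.2.2 p.1.2.2 * u j p) ∧ (∀ j, |ev j| < 2 * τ ∧ 0 ≤ wgt j ∧ wgt j * |ev j| ≤ 1) ∧ (∀ j, ‖∑ p, star (u j p) * gammaFive p.1.2.2 p.1.2.2 * u j p‖ < χ₀) ∧ 1 / (4 * τ) < ∑ j, wgt j * ∑ p, if childrenInterior (fun _ => (2 : ℕ)) p then (0 : ℝ) else ‖u j p‖ ^ 2) :=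
    fun U => achiralPileup_oneSiteBox_neg_four hN U τ χ₀ hτ hχ₀
  simp only [hE, if_true, one_mul]
  exact div_self hZ

/-! ## Off the point `μ = −4` the one-site box carries no achiral mode -/

/-- **The one-site exposure is exactly the point `μ = −4`.** On the box `s = (2,2,2,2)` at any cell
mass `μ ≠ −4`, for every gauge field, every level `τ` with `0 ≤ τ` and every cut `χ₀ ≤ 1`, the B″
event of the stub is EMPTY: the cell is `(μ+4)·1` (`wilsonCell_oneSiteBox`), so a unit eigenvector
`u` of the pencil has `(μ+4) u_p = ev (γ₅)_{α_pα_p} u_p`, whence `ev · χ(u) = μ + 4 ≠ 0` and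
`|ev| = |μ+4|` (read at a non-zero component), i.e. `‖χ(u)‖ = 1 ≥ χ₀` — every eigenvector is chiral.
So a guard keeping the sea masses off `−4` neutralises this box (the chain boxes need a margin). -/
theorem achiralPileup_oneSiteBox_empty_of_ne (U : GaugeConfig 4 N (Matrix.specialUnitaryGroup (Fin 3) ℂ))
    (μ τ χ₀ : ℝ) (hμ : μ ≠ -4) (hτ : 0 ≤ τ) (hχ₀ : χ₀ ≤ 1) :
    ¬ (∃ n : ℕ, ∃ u : Fin n → ({p // wilsonBox (0 : TorusSite 4 N) (fun _ => 2) p} → ℂ), ∃ ev wgt : Fin n → ℝ, (∀ i j, ∑ p, star (u i p) * u j p = if i = j then 1 else 0) ∧ (∀ j, (wilsonCell U μ 0 (fun _ => 2)).mulVec (u j) = fun p => (ev j : ℂ) * gammaFive p.1.2.2 p.1.2.2 * u j p) ∧ (∀ j, |ev j| < 2 * τ ∧ 0 ≤ wgt j ∧ wgt j * |ev j| ≤ 1) ∧ (∀ j, ‖∑ p, star (u j p) * gammaFive p.1.2.2 p.1.2.2 * u j p‖ < χ₀) ∧ 1 / (4 * τ) < ∑ j, wgt j * ∑ p, if childrenInterior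 (fun _ => (2 : ℕ)) p then (0 : ℝ) else ‖u j p‖ ^ 2) := by
  rintro ⟨n, u, ev, wgt, horth, heig, hbd, hach, hpile⟩
  rcases Nat.eq_zero_or_pos n with hn0 | hn
  · subst hn0
    simp only [Finset.univ_eq_empty, Finset.sum_empty] at hpile
    have h0 : (0 : ℝ) ≤ 1 / (4 * τ) := by positivity
    exact absurd hpile (not_lt.mpr h0)
  set j : Fin n := ⟨0, hn⟩
  set c : ℂ := ((μ + 4 : ℝ) : ℂ) with hc
  have hc0 : c ≠ 0 := by
    rw [hc, Ne, Complex.ofReal_eq_zero]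
    intro h
    exact hμ (by linarith)
  have hunit : ∑ p, star (u j p) * u j p = 1 := by rw [horth j j, if_pos rfl]
  -- the cell acts as the scalar `c`
  have hcell : (wilsonCell U μ 0 (fun _ => 2)).mulVec (u j) = fun p => c * u j p := by
    rw [wilsonCell_oneSiteBox, Matrix.smul_mulVec, Matrix.one_mulVec]
    rfl
  have hcomp : ∀ p, c * u j p = (ev j : ℂ) * gammaFive p.1.2.2 p.1.2.2 * u j p := fun p => by
    have := congrFun (heig j) p
    rwa [hcell] at this
  -- `ev · χ = c`
  set χ : ℂ := ∑ p, star (u j p) * gammaFive p.1.2.2 p.1.2.2 * u j p with hχ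
  have hevχ : (ev j : ℂ) * χ = c := by
    calc (ev j : ℂ) * χ = ∑ p, star (u j p) * ((ev j : ℂ) * gammaFive p.1.2.2 p.1.2.2 * u j p) := by
            rw [hχ, Finset.mul_sum]
            refine Finset.sum_congr rfl fun p _ => ?_
            ring
      _ = ∑ p, star (u j p) * (c * u j p) := by
            refine Finset.sum_congr rfl fun p _ => ?_
            rw [hcomp p]
      _ = c * ∑ p, star (u j p) * u j p := by
            rw [Finset.mul_sum]
            refine Finset.sum_congr rfl fun p _ => ?_
            ring
      _ = c := by rw [hunit, mul_one]
  -- `|ev| = ‖c‖`, read at a non-zero component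
  obtain ⟨p₀, hp₀⟩ : ∃ p, u j p ≠ 0 := by
    by_contra hzero
    push Not at hzero
    have : ∑ p, star (u j p) * u j p = 0 := Finset.sum_eq_zero fun p _ => by rw [hzero p, mul_zero]
    rw [hunit] at this
    exact one_ne_zero this
  have hγ : ‖(gammaFive p₀.1.2.2 p₀.1.2.2 : ℂ)‖ = 1 := by
    rw [gammaFive_eq_diagonal, Matrix.diagonal_apply_eq]
    rcases p₀ with ⟨⟨x, a, α⟩, hp⟩
    fin_cases α <;> simp
  have hev : ‖c‖ = |ev j| := by
    have h1 : c = (ev j : ℂ) * gammaFive p₀.1.2.2 p₀.1.2.2 :=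
      mul_right_cancel₀ hp₀ (by rw [hcomp p₀])
    rw [h1, norm_mul, hγ, mul_one, Complex.norm_real, Real.norm_eq_abs]
  -- hence `‖χ‖ = 1`, contradicting achirality at a cut `χ₀ ≤ 1`
  have hnormχ : |ev j| * ‖χ‖ = ‖c‖ := by
    rw [← hevχ, norm_mul, Complex.norm_real, Real.norm_eq_abs]
  have hcpos : 0 < ‖c‖ := norm_pos_iff.mpr hc0
  have hχ1 : ‖χ‖ = 1 := by
    rw [hev] at hnormχ hcpos
    field_simp at hnormχ
    linarith
  have := hach j
  rw [← hχ, hχ1] at this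
  linarith

/-- **Registered sub-goal form** (stub `stub5_oneSite_event_neg_four` of crux stmt-QuantumFields-13901,
line `chirality-collapses-pseudospectrum`): the exposure certificate — on the one-site box `(2,2,2,2)`
at cell mass `−4` the B″ event of `stub_achiralPileupRareOfPinned` holds for EVERY gauge field,
every level `τ > 0` and every cut `χ₀ > 0`. -/
theorem stub5_oneSite_event_neg_four :
    ∀ (N : ℕ) [NeZero N], 2 ≤ N → ∀ (U : GaugeConfig 4 N (Matrix.specialUnitaryGroup (Fin 3) ℂ)) (τ χ₀ : ℝ), 0 < τ → 0 < χ₀ → ∃ n : ℕ, ∃ u : Fin n → ({p // wilsonBox (0 : TorusSite 4 N) (fun _ => 2) p} → ℂ), ∃ ev wgt : Fin n → ℝ, (∀ i j, ∑ p, star (u i p) * u j p = if i = j then 1 else 0) ∧ (∀ j, (wilsonCell U (-4) 0 (fun _ => 2)).mulVec (u j) = fun p => (ev j : ℂ) * gammaFive p.1.2.2 p.1.2.2 * u j p) ∧ (∀ j, |ev j| < 2 * τ ∧ 0 ≤ wgt j ∧ wgt j * |ev j| ≤ 1) ∧ (∀ j, ‖∑ p, star (u j p) * gammaFive p.1.2.2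 p.1.2.2 * u j p‖ < χ₀) ∧ 1 / (4 * τ) < ∑ j, wgt j * ∑ p, if childrenInterior (fun _ => (2 : ℕ)) p then (0 : ℝ) else ‖u j p‖ ^ 2 :=
  fun _ _ hN U τ χ₀ hτ hχ₀ => achiralPileup_oneSiteBox_neg_four hN U τ χ₀ hτ hχ₀

end Summit.QuantumFields.QCD.Cruxes.CoerciveSea.ChiralityCollapsesPseudospectrum

end
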